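import Summits.BirchSwinnertonDyer.BirchSwinnertonDyer.Theorems.PrintCFramBottomClassIndexLawFiveLeLevelDictionary
import HarnessLib

/-!
# Route `PrintCFram`, crux C2 `BottomClassIndexLawFiveLe` (stmt-BirchSwinnertonDyer-20372), line
# `eisenstein-resource-bdp-line` (registry v18, stub B1 `stub_bsdp_of_classFactor`): **THE DÉVISSAGE COUNT** —
# `#C ≤ #R_Q · #R_S` for a subgroup `C ≤ H¹(G, M)` along `0 → S → M → Q → 0`, with the local conditions
# transferred to the quotient and to the sub
# (cell `bsd-print-cfram`, width seat `bsd-line-cfram-p1-w2` g9; helper `--supports` 20372; 0 defs, 0 facts, 0 sorry)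

HONEST FRAMING. Nothing about BSD is proved here, and nothing of any stub; this is pure continuous group
cohomology in degree one plus finite group theory. It is the COUNTING companion of w4's (α-core)
`LevelDictionary.unramified_quot_or_sub_of_locally_trivial` (which produces ONE non-zero class for the quotient
or the sub); here every class of a subgroup `C ≤ H¹(G, M)` is accounted for, so that `#C` is bounded by the
number of classes of `Q` and of `S` satisfying the transferred local conditions. Purpose on the line (seat notes
`Lines/eisenstein-resource-bdp-line-w2g8-notes.md` §4, LEAD g10 report §2 (a)–(c)): with `G = Γ_ℚ`, `M = W[p]`,
`S = Φ` the rational line of a CM-ramified class member, `C = Sel_p(W/ℚ)`, the bound reads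
`#Sel_p(W/ℚ) ≤ #R_•(θ_Q) · #R_•'(θ_S)` (the φ-DESCENT COUNT feeding `ParitySplit.bsdp_of_natCard_selmerGroup_le_sq`:
`#Sel_p ≤ p²` ∧ `p ∤ #Ш_an` ⟹ `BSD_p` in analytic rank one); the reading on the class is the companion file
`…SelmerDevissageCountRational`.

* §1 (finite group theory) `natCard_le_of_ker_le_range` — for additive maps `A —ι→ B —π→ D` with `π ∘ ι = 0`
  and `ker π ⊆ im ι`, a subgroup `C ≤ B`, and subgroups `R_D ≤ D`, `R_A ≤ A` (finite) with `π(C) ⊆ R_D` and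
  `ι⁻¹(C) ⊆ R_A`: **`#C ≤ #R_D · #R_A`** (`#C = #π(C) · #(C ∩ ker π)` and `ι⁻¹(C) ↠ C ∩ ker π`).
* §2 (cocycles; `G` a topological group, `S, M, Q` discrete `G`-modules, `ι : S → M`, `π : M → Q` equivariant,
  `ι` injective, `π` surjective, `ker π = im ι`, orbit maps of `M` continuous)
  `exists_incl_class_eq_of_proj_class_eq_zero` — EXACTNESS of `H¹(G,S) → H¹(G,M) → H¹(G,Q)` in the middle on
  classes; `exists_eq_smul_sub_on_of_incl_principal` — `Q^I = 0 ⟹ H¹(I,S) ↪ H¹(I,M)` on functions; the TRANSFERS of the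
  condition «coboundary on a subgroup `I`»: `proj_coboundaryOn` (to `Q`, always) and
  `coboundaryOn_of_incl_coboundaryOn` (to `S`, when `Q^I = 0` or `I` acts trivially on `M`).
* §3 THE COUNT `natCard_le_of_devissage` — for `C ≤ H¹(G, M)` and two families `𝓘_Q`, `𝓘_S` of subgroups of `G`
  such that `π_* c` is a coboundary on every `I ∈ 𝓘_Q` for `c ∈ C` and every `w : G → S` with `[ι ∘ w] ∈ C` is a
  coboundary on every `I ∈ 𝓘_S`: **`#C ≤ #(⨅_{I∈𝓘_Q} ker res_I)(Q) · #(⨅_{I∈𝓘_S} ker res_I)(S)`**;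
  `natCard_le_of_devissage_of_coboundaryOn` — the same from «every `c ∈ C` is a coboundary on every `I ∈ 𝓘`» for
  ONE family `𝓘` with `Q^I = 0 ∨ I` trivial on `M` for each `I ∈ 𝓘` (the transfers of §2).
* The DICHOTOMY at a distinguished subgroup `D` (ALIGNED or TRANSVERSE — «two lines in a plane», LEAD g10 report
  §2(a)) is the sequel file `…SelmerDevissageDichotomy`.

THEOREMS ONLY; no definition, no named fact, no `sorry`. BSD is not proved by any of this; no summit statement
is proved by this seat. References: [SerreGaloisCohomology1997] I.§2.2, I.§2.6 (b), I.§5.1; [SilvermanAEC2009]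
X.§4 (Ex. 4.8, Prop. 4.9: counting a Selmer group through an isogeny); Greenberg, LNM 1716 (1999) §3 (residual
Selmer groups of the sub and quotient characters); [SchaeferStoll2004] §6–7; the LEAD g10 report §2, seat notes
w2g8 §4.
-/

set_option autoImplicit false
-- `…BirchSwinnertonDyer.BirchSwinnertonDyer.Theorems…` is the problem's mandated namespace (D-0017).
set_option linter.dupNamespace false

noncomputable section

open scoped Classical

namespace Summit.BirchSwinnertonDyer.BirchSwinnertonDyer.Theorems.PrintCFram.SelmerCount

open Literature.NumberTheory.EllipticCurves Literature.NumberTheory.GaloisRepresentations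
open Summit.BirchSwinnertonDyer.BirchSwinnertonDyer.Theorems.PrintCFram.LevelDictionary

universe u

/-! ## §1 Finite group theory -/

section Algebra

variable {A B D : Type*} [AddCommGroup A] [AddCommGroup B] [AddCommGroup D]

/-- **Counting a subgroup through a complex.** For additive maps `ι : A → B`, `π : B → D` with `π ∘ ι = 0` and
`ker π ⊆ im ι`, a subgroup `C ≤ B` and FINITE subgroups `R_D ≤ D`, `R_A ≤ A` such that `π(C) ⊆ R_D` and every
`a` with `ι a ∈ C` lies in `R_A`: `#C ≤ #R_D · #R_A`. (`#C = #π(C) · #(C ∩ ker π)` by Lagrange; `π(C) ↪ R_D`;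
`{a ∈ R_A : ι a ∈ C} ↠ C ∩ ker π` by exactness.) [folklore] -/
theorem natCard_le_of_ker_le_range (ι : A →+ B) (π : B →+ D) (hπι : ∀ a, π (ι a) = 0)
    (hexact : ∀ b, π b = 0 → ∃ a, ι a = b)
    (C : AddSubgroup B) (RD : AddSubgroup D) (RA : AddSubgroup A) [Finite RD] [Finite RA]
    (hCD : ∀ c ∈ C, π c ∈ RD) (hCA : ∀ a, ι a ∈ C → a ∈ RA) :
    Nat.card C ≤ Nat.card RD * Nat.card RA := by
  let f : C →+ D := π.comp C.subtype
  have hf : ∀ c : C, f c = π c := fun _ ↦ rfl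
  have hC : Nat.card C = Nat.card f.range * Nat.card f.ker := by
    rw [AddSubgroup.card_eq_card_quotient_mul_card_addSubgroup f.ker,
      Nat.card_congr (QuotientAddGroup.quotientKerEquivRange f).toEquiv]
  -- `range f ↪ R_D`
  have h1 : Nat.card f.range ≤ Nat.card RD := by
    refine Nat.card_le_card_of_injective (fun x : f.range ↦ (⟨x.1, ?_⟩ : RD)) ?_
    · obtain ⟨c, hc⟩ := x.2
      rw [← hc, hf]
      exact hCD c c.2
    · intro x y hxy
      simp only [Subtype.mk.injEq] at hxy
      exact Subtype.ext hxy
  -- `{a ∈ R_A : ι a ∈ C} ↠ ker f`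
  have h2 : Nat.card f.ker ≤ Nat.card RA := by
    let g : {a : RA // ι a.1 ∈ C} → f.ker := fun a ↦
      ⟨⟨ι a.1.1, a.2⟩, by rw [AddMonoidHom.mem_ker, hf]; exact hπι _⟩
    have hg : Function.Surjective g := by
      rintro ⟨⟨c, hcC⟩, hc⟩
      rw [AddMonoidHom.mem_ker, hf] at hc
      obtain ⟨a, ha⟩ := hexact c hc
      have haC : ι a ∈ C := by rw [ha]; exact hcC
      refine ⟨⟨⟨a, hCA a haC⟩, haC⟩, Subtype.ext (Subtype.ext ?_)⟩
      exact ha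
    exact (Nat.card_le_card_of_surjective g hg).trans (Finite.card_subtype_le _)
  rw [hC]
  exact Nat.mul_le_mul h1 h2

end Algebra

/-! ## §2 Cocycles: exactness in the middle, injectivity, transfer of local conditions -/

section Cocycles

variable {G : Type u} [Group G] [TopologicalSpace G] [IsTopologicalGroup G]
variable {S M Q : Type u} [AddCommGroup S] [AddCommGroup M] [AddCommGroup Q]
  [DistribMulAction G S] [DistribMulAction G M] [DistribMulAction G Q]
  [TopologicalSpace S] [DiscreteTopology S] [TopologicalSpace M] [DiscreteTopology M]
  [TopologicalSpace Q] [DiscreteTopology Q]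

omit [DistribMulAction G Q] [TopologicalSpace Q] [DiscreteTopology Q] [AddCommGroup Q] in
/-- Two continuous crossed homomorphisms `G → M` that agree pointwise have the same class. [folklore] -/
theorem oneCocycleClass_congr {z z' : contOneCocycles (discreteTopRep G M)} (h : ∀ g, z.1 g = z'.1 g) :
    oneCocycleClass (discreteTopRep G M) z = oneCocycleClass (discreteTopRep G M) z' := by
  have : z = z' := Subtype.ext (ContinuousMap.ext h)
  rw [this]

omit [DistribMulAction G Q] [TopologicalSpace Q] [DiscreteTopology Q] [AddCommGroup Q]
  [DistribMulAction G S] [TopologicalSpace S] [DiscreteTopology S] [AddCommGroup S] in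
/-- The continuous coboundary `g ↦ g • m₁ − m₁` of a discrete `G`-module with continuous orbit maps, as a
continuous crossed homomorphism, has the zero class. [cite: SerreGaloisCohomology1997, I.§5.1] -/
theorem exists_coboundary_cocycle (hM : ∀ m : M, Continuous fun g : G ↦ g • m) (m₁ : M) :
    ∃ b : contOneCocycles (discreteTopRep G M), (∀ g, b.1 g = g • m₁ - m₁) ∧
      oneCocycleClass (discreteTopRep G M) b = 0 := by
  haveI : ContinuousSub M := ⟨continuous_of_discreteTopology⟩
  let b : contOneCocycles (discreteTopRep G M) :=
    ⟨⟨fun g ↦ g • m₁ - m₁, (hM m₁).sub continuous_const⟩, fun g h ↦ by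
      change (g * h) • m₁ - m₁ = g • m₁ - m₁ + g • (h • m₁ - m₁)
      rw [mul_smul, smul_sub]
      abel⟩
  exact ⟨b, fun _ ↦ rfl, (oneCocycleClass_eq_zero_iff _ b).2 ⟨m₁, fun _ ↦ rfl⟩⟩

/-- **Exactness of `H¹(G,S) → H¹(G,M) → H¹(G,Q)` in the middle, on classes.** If the push-forward `π ∘ z` of a
continuous crossed homomorphism `z : G → M` has the zero class, then `[z] = [ι ∘ w]` for a continuous crossed
homomorphism `w : G → S`: `π ∘ z = ∂q₀`, `q₀ = π m₁`, and `z − ∂m₁` takes values in `ker π = ι(S)`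
(`LevelDictionary.exists_preimage_cocycle`). [cite: SerreGaloisCohomology1997, I.§2.6 (b) and I.§5.1] -/
theorem exists_incl_class_eq_of_proj_class_eq_zero
    (hM : ∀ m : M, Continuous fun g : G ↦ g • m)
    (ι : S →+ M) (π : M →+ Q)
    (hι : ∀ (g : G) (s : S), ι (g • s) = g • ι s) (hπ : ∀ (g : G) (m : M), π (g • m) = g • π m)
    (hιinj : Function.Injective ι) (hπsurj : Function.Surjective π)
    (hker : ∀ m, π m = 0 → ∃ s, ι s = m)
    (z : contOneCocycles (discreteTopRep G M))
    (hz : oneCocycleClass (discreteTopRep G Q)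
      (contOneCocycles.pullback (ContinuousMonoidHom.id G)
        (resHomOfEquivariant (ContinuousMonoidHom.id G) π hπ) z) = 0) :
    ∃ w : contOneCocycles (discreteTopRep G S),
      oneCocycleClass (discreteTopRep G M)
        (contOneCocycles.pullback (ContinuousMonoidHom.id G)
          (resHomOfEquivariant (ContinuousMonoidHom.id G) ι hι) w) =
      oneCocycleClass (discreteTopRep G M) z := by
  obtain ⟨q₀, hq₀⟩ := (oneCocycleClass_eq_zero_iff _ _).1 hz
  obtain ⟨m₁, hm₁⟩ := hπsurj q₀
  obtain ⟨b, hb, hb0⟩ := exists_coboundary_cocycle hM m₁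
  -- `z - ∂m₁` takes values in `ι(S)`
  have hval : ∀ g, ∃ s : S, ι s = (z - b).1 g := by
    intro g
    apply hker
    change π (z.1 g - b.1 g) = 0
    rw [map_sub, hb g, map_sub, hπ, hm₁]
    have h := hq₀ g
    rw [pullback_id_apply] at h
    rw [h]
    exact sub_self _
  obtain ⟨w, hw⟩ := exists_preimage_cocycle ι hι hιinj (z - b) hval
  refine ⟨w, ?_⟩
  have hcl : oneCocycleClass (discreteTopRep G M)
      (contOneCocycles.pullback (ContinuousMonoidHom.id G)
        (resHomOfEquivariant (ContinuousMonoidHom.id G) ι hι) w) =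
      oneCocycleClass (discreteTopRep G M) (z - b) :=
    oneCocycleClass_congr fun g ↦ by rw [pullback_id_apply, hw g]
  rw [hcl, oneCocycleClass_sub, hb0, sub_zero]

omit [IsTopologicalGroup G] [DistribMulAction G S] [TopologicalSpace S] [DiscreteTopology S]
  [AddCommGroup S] in
/-- **Transfer to the quotient.** If `z : G → M` is a coboundary on the subgroup `I` (`z g = g v − v` on `I`),
so is its push-forward: `π (z g) = g (π v) − π v` on `I`. [cite: SerreGaloisCohomology1997, I.§5.1] -/
theorem proj_coboundaryOn (π : M →+ Q) (hπ : ∀ (g : G) (m : M), π (g • m) = g • π m)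
    (z : contOneCocycles (discreteTopRep G M)) (I : Subgroup G) {v : M}
    (hv : ∀ g ∈ I, z.1 g = g • v - v) :
    ∀ g ∈ I, (contOneCocycles.pullback (ContinuousMonoidHom.id G)
      (resHomOfEquivariant (ContinuousMonoidHom.id G) π hπ) z).1 g = g • π v - π v := fun g hg ↦ by
  rw [pullback_id_apply, hv g hg, map_sub, hπ]

end Cocycles

/-! ### Push-forward along `ι`: injectivity and the transfer to the sub (no topology) -/

section Push

variable {G : Type u} [Group G]
variable {S M Q : Type u} [AddCommGroup S] [AddCommGroup M] [AddCommGroup Q]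
  [DistribMulAction G S] [DistribMulAction G M] [DistribMulAction G Q]

/-- **`H⁰(G, Q) = 0 ⟹ H¹(G, S) → H¹(G, M)` injective, on functions**: if `ι ∘ w` is principal
(`ι (w g) = g m₀ − m₀`) then `w` is principal (`π m₀ ∈ Q^G = 0`, so `m₀ = ι s₀`, `w = ∂s₀`). The same holds on any
subgroup `I ≤ G` with `Q^I = 0`. [cite: SerreGaloisCohomology1997, I.§2.6 (b) and I.§5.1] -/
theorem exists_eq_smul_sub_on_of_incl_principal (ι : S →+ M) (π : M →+ Q)
    (hι : ∀ (g : G) (s : S), ι (g • s) = g • ι s) (hπ : ∀ (g : G) (m : M), π (g • m) = g • π m)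
    (hιinj : Function.Injective ι) (hπι : ∀ s, π (ι s) = 0) (hker : ∀ m, π m = 0 → ∃ s, ι s = m)
    (I : Subgroup G) (hQI : ∀ q : Q, (∀ g ∈ I, g • q = q) → q = 0)
    (w : G → S) {m₀ : M} (hw : ∀ g ∈ I, ι (w g) = g • m₀ - m₀) :
    ∃ s₀ : S, ∀ g ∈ I, w g = g • s₀ - s₀ := by
  have hπm : ∀ g ∈ I, g • π m₀ = π m₀ := fun g hg ↦ by
    have h := congrArg π (hw g hg)
    rw [hπι, map_sub, hπ] at h
    exact sub_eq_zero.1 h.symm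
  obtain ⟨s₀, hs₀⟩ := hker m₀ (hQI _ hπm)
  refine ⟨s₀, fun g hg ↦ hιinj ?_⟩
  rw [hw g hg, ← hs₀, map_sub, hι]

/-- **Transfer to the sub.** If `ι ∘ w` is a coboundary on the subgroup `I` (`ι (w g) = g v − v` on `I`) and
EITHER `Q` has no non-zero `I`-invariant OR `I` acts trivially on `M`, then `w` is a coboundary on `I`:
in the first case `π v ∈ Q^I = 0`, so `v = ι s₀` and `w = ∂s₀` on `I`; in the second `w = 0` on `I`.
[cite: SerreGaloisCohomology1997, I.§2.6 (b) and I.§5.1] -/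
theorem coboundaryOn_of_incl_coboundaryOn (ι : S →+ M) (π : M →+ Q)
    (hι : ∀ (g : G) (s : S), ι (g • s) = g • ι s) (hπ : ∀ (g : G) (m : M), π (g • m) = g • π m)
    (hιinj : Function.Injective ι) (hπι : ∀ s, π (ι s) = 0) (hker : ∀ m, π m = 0 → ∃ s, ι s = m)
    (I : Subgroup G)
    (hQI : (∀ q : Q, (∀ g ∈ I, g • q = q) → q = 0) ∨ (∀ g ∈ I, ∀ m : M, g • m = m))
    (w : G → S) {v : M} (hv : ∀ g ∈ I, ι (w g) = g • v - v) :
    ∃ s : S, ∀ g ∈ I, w g = g • s - s := by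
  rcases hQI with hQI | htriv
  · exact exists_eq_smul_sub_on_of_incl_principal ι π hι hπ hιinj hπι hker I hQI w hv
  · refine ⟨0, fun g hg ↦ hιinj ?_⟩
    rw [hv g hg, htriv g hg, sub_self, smul_zero, sub_zero, map_zero]

end Push

/-! ## §3 The count `#C ≤ #R_Q · #R_S` -/

section Count

variable {G : Type u} [Group G] [TopologicalSpace G] [IsTopologicalGroup G]
variable {S M Q : Type u} [AddCommGroup S] [AddCommGroup M] [AddCommGroup Q]
  [DistribMulAction G S] [DistribMulAction G M] [DistribMulAction G Q]
  [TopologicalSpace S] [DiscreteTopology S] [TopologicalSpace M] [DiscreteTopology M]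
  [TopologicalSpace Q] [DiscreteTopology Q]

/-- **THE DÉVISSAGE COUNT.** `G` a topological group; `S, M, Q` discrete `G`-modules, the orbit maps of `M`
continuous; `ι : S → M`, `π : M → Q` equivariant with `ι` injective, `π` surjective, `ker π = im ι`. Let
`C ≤ H¹(G, M)` be a subgroup and `𝓘_Q`, `𝓘_S` two families of subgroups of `G` such that (i) for every continuous
crossed homomorphism `z : G → M` with `[z] ∈ C`, the push-forward `π ∘ z` is a coboundary on every `I ∈ 𝓘_Q`, and
(ii) every continuous crossed homomorphism `w : G → S` with `[ι ∘ w] ∈ C` is a coboundary on every `I ∈ 𝓘_S`.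
If the groups `R_Q = ⋂_{I ∈ 𝓘_Q} ker (H¹(G,Q) → H¹(I,Q))` and `R_S = ⋂_{I ∈ 𝓘_S} ker (H¹(G,S) → H¹(I,S))` are
finite, then **`#C ≤ #R_Q · #R_S`**. (`π_*(C) ⊆ R_Q`, `ι_*⁻¹(C) ⊆ R_S`, exactness in the middle, §1.)
[cite: SerreGaloisCohomology1997, I.§2.6 (b) and I.§5.1] [cite: SilvermanAEC2009, X.§4 (Ex. 4.8, Prop. 4.9)] -/
theorem natCard_le_of_devissage
    (hM : ∀ m : M, Continuous fun g : G ↦ g • m)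
    (ι : S →+ M) (π : M →+ Q)
    (hι : ∀ (g : G) (s : S), ι (g • s) = g • ι s) (hπ : ∀ (g : G) (m : M), π (g • m) = g • π m)
    (hιinj : Function.Injective ι) (hπsurj : Function.Surjective π)
    (hπι : ∀ s, π (ι s) = 0) (hker : ∀ m, π m = 0 → ∃ s, ι s = m)
    (C : AddSubgroup (discreteH1 G M)) (𝓘Q 𝓘S : Set (Subgroup G))
    (hCQ : ∀ z : contOneCocycles (discreteTopRep G M), oneCocycleClass _ z ∈ C →
      ∀ I ∈ 𝓘Q, ∃ q : Q, ∀ g ∈ I, π (z.1 g) = g • q - q)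
    (hCS : ∀ w : contOneCocycles (discreteTopRep G S),
      oneCocycleClass (discreteTopRep G M) (contOneCocycles.pullback (ContinuousMonoidHom.id G)
        (resHomOfEquivariant (ContinuousMonoidHom.id G) ι hι) w) ∈ C →
      ∀ I ∈ 𝓘S, ∃ s : S, ∀ g ∈ I, w.1 g = g • s - s)
    (hfinQ : Finite ↥(⨅ I ∈ 𝓘Q, subgroupResKer Q I))
    (hfinS : Finite ↥(⨅ I ∈ 𝓘S, subgroupResKer S I)) :
    Nat.card C ≤ Nat.card ↥(⨅ I ∈ 𝓘Q, subgroupResKer Q I) * Nat.card ↥(⨅ I ∈ 𝓘S, subgroupResKer S I) := by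
  -- the induced maps on `H¹`
  let πH : discreteH1 G M →+ discreteH1 G Q :=
    (ContinuousCohomology.map (ContinuousMonoidHom.id G)
      (resHomOfEquivariant (ContinuousMonoidHom.id G) π hπ) 1).hom.toLinearMap.toAddMonoidHom
  let ιH : discreteH1 G S →+ discreteH1 G M :=
    (ContinuousCohomology.map (ContinuousMonoidHom.id G)
      (resHomOfEquivariant (ContinuousMonoidHom.id G) ι hι) 1).hom.toLinearMap.toAddMonoidHom
  have hπH : ∀ z, πH (oneCocycleClass _ z) = oneCocycleClass (discreteTopRep G Q)
      (contOneCocycles.pullback (ContinuousMonoidHom.id G)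
        (resHomOfEquivariant (ContinuousMonoidHom.id G) π hπ) z) := fun z ↦
    map_oneCocycleClass _ _ _ z
  have hιH : ∀ w, ιH (oneCocycleClass _ w) = oneCocycleClass (discreteTopRep G M)
      (contOneCocycles.pullback (ContinuousMonoidHom.id G)
        (resHomOfEquivariant (ContinuousMonoidHom.id G) ι hι) w) := fun w ↦
    map_oneCocycleClass _ _ _ w
  -- `π ∘ ι = 0` on `H¹`
  have hzero : ∀ a, πH (ιH a) = 0 := by
    intro a
    obtain ⟨w, rfl⟩ := oneCocycleClass_surjective _ a
    rw [hιH, hπH, oneCocycleClass_eq_zero_iff]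
    exact ⟨0, fun g ↦ by
      rw [pullback_id_apply, pullback_id_apply, hπι, map_zero, sub_zero]⟩
  -- exactness in the middle
  have hexact : ∀ b, πH b = 0 → ∃ a, ιH a = b := by
    intro b hb
    obtain ⟨z, rfl⟩ := oneCocycleClass_surjective _ b
    rw [hπH] at hb
    obtain ⟨w, hw⟩ := exists_incl_class_eq_of_proj_class_eq_zero hM ι π hι hπ hιinj hπsurj hker z hb
    exact ⟨oneCocycleClass _ w, by rw [hιH, hw]⟩
  haveI := hfinQ
  haveI := hfinS
  refine natCard_le_of_ker_le_range ιH πH hzero hexact C _ _ ?_ ?_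
  · -- `π_*(C) ⊆ R_Q`
    intro c hc
    obtain ⟨z, rfl⟩ := oneCocycleClass_surjective _ c
    rw [hπH, AddSubgroup.mem_iInf]
    intro I
    rw [AddSubgroup.mem_iInf]
    intro hI
    rw [oneCocycleClass_mem_subgroupResKer_iff]
    obtain ⟨q, hq⟩ := hCQ z hc I hI
    exact ⟨q, fun σ ↦ by rw [pullback_id_apply]; exact hq σ σ.2⟩
  · -- `ι_*⁻¹(C) ⊆ R_S`
    intro a ha
    obtain ⟨w, rfl⟩ := oneCocycleClass_surjective _ a
    rw [hιH] at ha
    rw [AddSubgroup.mem_iInf]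
    intro I
    rw [AddSubgroup.mem_iInf]
    intro hI
    rw [oneCocycleClass_mem_subgroupResKer_iff]
    obtain ⟨s, hs⟩ := hCS w ha I hI
    exact ⟨s, fun σ ↦ hs σ σ.2⟩

/-- **THE DÉVISSAGE COUNT from local conditions on `C`.** As `natCard_le_of_devissage`, for ONE family `𝓘` of
subgroups of `G` such that for every `I ∈ 𝓘` EITHER `Q` has no non-zero `I`-invariant OR `I` acts trivially on
`M`, and a subgroup `C ≤ H¹(G, M)` every class of which restricts to zero on every `I ∈ 𝓘`:
**`#C ≤ #R_Q(𝓘) · #R_S(𝓘)`** with `R_A(𝓘) = ⋂_{I ∈ 𝓘} ker (H¹(G,A) → H¹(I,A))` (transfers §2).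
[cite: SerreGaloisCohomology1997, I.§2.6 (b) and I.§5.1] [cite: GreenbergLNM1716, §3 (PDF p. 86)] -/
theorem natCard_le_of_devissage_of_coboundaryOn
    (hM : ∀ m : M, Continuous fun g : G ↦ g • m)
    (ι : S →+ M) (π : M →+ Q)
    (hι : ∀ (g : G) (s : S), ι (g • s) = g • ι s) (hπ : ∀ (g : G) (m : M), π (g • m) = g • π m)
    (hιinj : Function.Injective ι) (hπsurj : Function.Surjective π)
    (hπι : ∀ s, π (ι s) = 0) (hker : ∀ m, π m = 0 → ∃ s, ι s = m)
    (𝓘 : Set (Subgroup G))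
    (hQ𝓘 : ∀ I ∈ 𝓘, (∀ q : Q, (∀ g ∈ I, g • q = q) → q = 0) ∨ (∀ g ∈ I, ∀ m : M, g • m = m))
    (C : AddSubgroup (discreteH1 G M)) (hC : ∀ c ∈ C, ∀ I ∈ 𝓘, c ∈ subgroupResKer M I)
    (hfinQ : Finite ↥(⨅ I ∈ 𝓘, subgroupResKer Q I))
    (hfinS : Finite ↥(⨅ I ∈ 𝓘, subgroupResKer S I)) :
    Nat.card C ≤ Nat.card ↥(⨅ I ∈ 𝓘, subgroupResKer Q I) * Nat.card ↥(⨅ I ∈ 𝓘, subgroupResKer S I) := by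
  refine natCard_le_of_devissage hM ι π hι hπ hιinj hπsurj hπι hker C 𝓘 𝓘 ?_ ?_ hfinQ hfinS
  · intro z hz I hI
    obtain ⟨v, hv⟩ := (oneCocycleClass_mem_subgroupResKer_iff I z).1 (hC _ hz I hI)
    exact ⟨π v, fun g hg ↦ by rw [hv ⟨g, hg⟩, map_sub, hπ]⟩
  · intro w hw I hI
    obtain ⟨v, hv⟩ := (oneCocycleClass_mem_subgroupResKer_iff I _).1 (hC _ hw I hI)
    exact coboundaryOn_of_incl_coboundaryOn ι π hι hπ hιinj hπι hker I (hQ𝓘 I hI) w.1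
      (v := v) fun g hg ↦ hv ⟨g, hg⟩

end Count

end Summit.BirchSwinnertonDyer.BirchSwinnertonDyer.Theorems.PrintCFram.SelmerCount

end
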